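import Mathlib.GroupTheory.Complement
import Summits.MatrixMultiplication.OmegaCensus.BoxBadCommutingPairs

/-!
# ω-census, family (b3): conjecture C9 (b) — one element with two commuting partners and two distinct central involution commutators gives box ratio `≥ 2`

HONEST FRAMING (pub-omega census; verbatim): lottery ticket; floor = certified bounds/negative ranges.
Census BOOKKEEPING (conjecture C9 of the cell, STRUCTURE.md §2; pub-omega kernel-l4 gen 15, task K-4 = the `p = 2` side of
`BoxBadOddPGroups`).  TYPE II-a of the minimal bad `2`-groups (`G′ = C₂² = Ω₁(Z)`, centre index `8`: nine groups of order `64`,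
`C2CubeExtension`; nine of order `128`; the class-`2` ones of order `32`) all contain the configuration of this file, which is settled
UNIFORMLY, like `BoxBadCommutingPairs` (type I):

**Theorem (`exists_indep_twoComm`).** Let `x, y, w ∈ G` with `y w = w y`, `x y x⁻¹ y⁻¹ = c₁`, `x w x⁻¹ w⁻¹ = c₂`, where `c₁ ≠ c₂` are
central involutions (`≠ 1`).  With `K` a transversal of `N = {1, c₁, c₂, c₁c₂}` the `8|K| ≥ 2|G|` cells
`(c₁k,1,1)`, `(x⁻¹c₁c₂k,1,x)`, `(w⁻¹c₁c₂k,1,w)`, `(x⁻¹k,x,1)`, `(x⁻¹x⁻¹c₂k,x,x)`, `(w⁻¹x⁻¹c₂k,x,w)`, `(y⁻¹k,y,1)`, `(w⁻¹y⁻¹c₂k,y,w)` (`k ∈ K`) of the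
box `G × {1, x, y} × {1, x, w}` are independent (the `64` word equations close under one simp normal form: the sixteen signed
conjugation rules of the two pairs, the `y`–`w` commutations and `c`-fronting).  Found from the seat's data: on the `36` cells of a
`N`-coset key the conflict graph is a fixed graph of independence number `8` (brute force), and the finder reaches `2|G|` on this box
in all nine order-`64` classes.  **Corollary (`not_boxUseful_of_twoComm`)**: such a finite group is not box-useful.  This covers every
type II-a minimal bad `2`-group at once (all orders), decide-free.  Nothing here is progress on `ω`.
-/

namespace Summit.MatrixMultiplication.OmegaCensus

open Finset ProductBoxBound

namespace CommPairs

variable {G : Type*} [Group G]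

/-- `[x, y⁻¹] = c` from `[x, y] = c` (central involution `c`). [folklore] -/
theorem comm_inv_right {x y c : G} (h : x * y * x⁻¹ * y⁻¹ = c) (hc : ∀ g : G, g * c = c * g) (hcc : c * c = 1) :
    x * y⁻¹ * x⁻¹ * y⁻¹⁻¹ = c := by
  have A : x * y * x⁻¹ = c * y := by rw [← h]; group
  have hci : c⁻¹ = c := by rw [inv_eq_iff_mul_eq_one, hcc]
  calc x * y⁻¹ * x⁻¹ * y⁻¹⁻¹ = (x * y * x⁻¹)⁻¹ * y := by group
    _ = (c * y)⁻¹ * y := by rw [A]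
    _ = y⁻¹ * (c⁻¹ * y) := by group
    _ = y⁻¹ * (c * y) := by rw [hci]
    _ = y⁻¹ * (y * c) := by rw [hc y]
    _ = c := by group

/-- `[x⁻¹, y] = c` from `[x, y] = c` (central involution `c`). [folklore] -/
theorem comm_inv_left {x y c : G} (h : x * y * x⁻¹ * y⁻¹ = c) (hc : ∀ g : G, g * c = c * g) (hcc : c * c = 1) :
    x⁻¹ * y * x⁻¹⁻¹ * y⁻¹ = c := by
  have A : x * y * x⁻¹ = c * y := by rw [← h]; group
  have hci : c⁻¹ = c := by rw [inv_eq_iff_mul_eq_one, hcc]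
  have C : x⁻¹ * y * x = c⁻¹ * y := by
    apply eq_inv_mul_of_mul_eq
    calc c * (x⁻¹ * y * x) = (c * x⁻¹) * y * x := by group
      _ = (x⁻¹ * c) * y * x := by rw [hc x⁻¹]
      _ = x⁻¹ * (c * y) * x := by group
      _ = x⁻¹ * (x * y * x⁻¹) * x := by rw [A]
      _ = y := by group
  calc x⁻¹ * y * x⁻¹⁻¹ * y⁻¹ = (x⁻¹ * y * x) * y⁻¹ := by group
    _ = c⁻¹ * y * y⁻¹ := by rw [C]
    _ = c := by rw [hci]; group

/-- `[y, x] = c` from `[x, y] = c` (involution `c`). [folklore] -/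
theorem comm_symm {x y c : G} (h : x * y * x⁻¹ * y⁻¹ = c) (hcc : c * c = 1) : y * x * y⁻¹ * x⁻¹ = c := by
  have hci : c⁻¹ = c := by rw [inv_eq_iff_mul_eq_one, hcc]
  calc y * x * y⁻¹ * x⁻¹ = (x * y * x⁻¹ * y⁻¹)⁻¹ := by group
    _ = c := by rw [h, hci]

set_option maxHeartbeats 4000000 in
/-- **The uniform ratio-`2` witness for `[x,y] = c₁`, `[x,w] = c₂`, `[y,w] = 1` (central involutions `c₁ ≠ c₂`).** [folklore] -/
theorem exists_indep_twoComm [Fintype G] [DecidableEq G] {x y w c₁ c₂ : G}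
    (h1 : x * y * x⁻¹ * y⁻¹ = c₁) (h2 : x * w * x⁻¹ * w⁻¹ = c₂) (hyw : y * w = w * y)
    (hz1 : c₁ ∈ Subgroup.center G) (hz2 : c₂ ∈ Subgroup.center G) (h10 : c₁ ≠ 1) (h20 : c₂ ≠ 1) (h12 : c₁ ≠ c₂)
    (h11 : c₁ * c₁ = 1) (h22 : c₂ * c₂ = 1) :
    ∃ (Y W : Finset G) (J : Finset (G × G × G)), #Y = 3 ∧ #W = 3 ∧ J ⊆ univ ×ˢ (Y ×ˢ W) ∧
      (∀ P ∈ J, ∀ P' ∈ J, P ≠ P' → cellWord P P' ≠ 1) ∧ 2 * Fintype.card G ≤ #J := by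
  classical
  -- centrality and normalisation rules
  have cc1 : ∀ g : G, g * c₁ = c₁ * g := fun g => Subgroup.mem_center_iff.mp hz1 g
  have cc2 : ∀ g : G, g * c₂ = c₂ * g := fun g => Subgroup.mem_center_iff.mp hz2 g
  have cl1 : ∀ g t : G, g * (c₁ * t) = c₁ * (g * t) := fun g t => by rw [← mul_assoc, cc1 g, mul_assoc]
  have cl2 : ∀ g t : G, g * (c₂ * t) = c₂ * (g * t) := fun g t => by rw [← mul_assoc, cc2 g, mul_assoc]
  have i1 : c₁⁻¹ = c₁ := by rw [inv_eq_iff_mul_eq_one, h11]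
  have i2 : c₂⁻¹ = c₂ := by rw [inv_eq_iff_mul_eq_one, h22]
  have q1 : ∀ t : G, c₁ * (c₁ * t) = t := fun t => by rw [← mul_assoc, h11, one_mul]
  have q2 : ∀ t : G, c₂ * (c₂ * t) = t := fun t => by rw [← mul_assoc, h22, one_mul]
  have cyw : Commute w y := hyw.symm
  -- the signed conjugation rules that the normal form needs
  have hxy1 := h1
  have hxy2 := comm_inv_right h1 cc1 h11
  have hyx1 := comm_symm h1 h11
  have hxw1 := h2
  have hxw2 := comm_inv_right h2 cc2 h22
  have hwx1 := comm_symm h2 h22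
  have hwx2 := comm_inv_right hwx1 cc2 h22
  have R := fun {a b c : G} (h : a * b * a⁻¹ * b⁻¹ = c) (t : G) => conj_rule h t
  have Rxy1 : ∀ t, x * (y * (x⁻¹ * t)) = c₁ * (y * t) := fun t => R hxy1 t
  have Rxy2 : ∀ t, x * (y⁻¹ * (x⁻¹ * t)) = c₁ * (y⁻¹ * t) := fun t => R hxy2 t
  have Ryx1 : ∀ t, y * (x * (y⁻¹ * t)) = c₁ * (x * t) := fun t => R hyx1 t
  have Rxw1 : ∀ t, x * (w * (x⁻¹ * t)) = c₂ * (w * t) := fun t => R hxw1 t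
  have Rxw2 : ∀ t, x * (w⁻¹ * (x⁻¹ * t)) = c₂ * (w⁻¹ * t) := fun t => R hxw2 t
  have Rwx1 : ∀ t, w * (x * (w⁻¹ * t)) = c₂ * (x * t) := fun t => R hwx1 t
  have Rwx2 : ∀ t, w * (x⁻¹ * (w⁻¹ * t)) = c₂ * (x⁻¹ * t) := fun t => R hwx2 t
  -- compound conjugation rules `x^ε (y^± (w^± (x^∓ t))) = c₁ (c₂ (y^± (w^± t)))`
  have comp : ∀ {a a' b d : G}, a' * a = 1 → (∀ t, a * (b * (a' * t)) = c₁ * (b * t)) →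
      (∀ t, a * (d * (a' * t)) = c₂ * (d * t)) → ∀ t, a * (b * (d * (a' * t))) = c₁ * (c₂ * (b * (d * t))) := by
    intro a a' b d haa hb hd t
    have ins : a' * (a * (d * (a' * t))) = d * (a' * t) := by rw [← mul_assoc, haa, one_mul]
    rw [← ins, hb, hd, cl2 b]
  have X1 := comp (inv_mul_cancel x) Rxy1 Rxw1
  have X4 := comp (inv_mul_cancel x) Rxy2 Rxw2
  -- distinctness inside `Y` and `W`
  have hx1 : x ≠ 1 := by rintro rfl; apply h10; rw [← h1]; group
  have hy1 : y ≠ 1 := by rintro rfl; apply h10; rw [← h1]; group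
  have hxy : x ≠ y := by rintro rfl; apply h10; rw [← h1]; group
  have hw1 : w ≠ 1 := by rintro rfl; apply h20; rw [← h2]; group
  have hxw : x ≠ w := by rintro rfl; apply h20; rw [← h2]; group
  -- the subgroup `N = {1, c₁, c₂, c₁c₂}` and a transversal
  have h21 : c₂ * c₁ = c₁ * c₂ := cc1 c₂
  let S : Finset G := {1, c₁, c₂, c₁ * c₂}
  have memS : ∀ g : G, g ∈ S ↔ g = 1 ∨ g = c₁ ∨ g = c₂ ∨ g = c₁ * c₂ := fun g => by
    simp only [S, Finset.mem_insert, Finset.mem_singleton]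
  let N : Subgroup G :=
    { carrier := ↑S
      mul_mem' := by
        intro a b ha hb
        rw [Finset.mem_coe, memS] at ha hb ⊢
        rcases ha with rfl | rfl | rfl | rfl <;> rcases hb with rfl | rfl | rfl | rfl <;>
          simp [h11, h22, h21, mul_assoc, q1, cl1]
      one_mem' := by rw [Finset.mem_coe, memS]; exact Or.inl rfl
      inv_mem' := by
        intro a ha
        rw [Finset.mem_coe, memS] at ha ⊢
        rcases ha with rfl | rfl | rfl | rfl
        · exact Or.inl inv_one
        · exact Or.inr (Or.inl i1)
        · exact Or.inr (Or.inr (Or.inl i2))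
        · right; right; right; rw [mul_inv_rev, i1, i2, h21] }
  have memN : ∀ g : G, g ∈ N ↔ g = 1 ∨ g = c₁ ∨ g = c₂ ∨ g = c₁ * c₂ := fun g => by
    rw [← memS]; exact Iff.rfl
  have cardN : Nat.card N ≤ 4 := by
    have : Nat.card N = Nat.card (↑S : Set G) := rfl
    rw [this, Nat.card_coe_set_eq, Set.ncard_coe_finset]
    exact (Finset.card_insert_le _ _).trans (Nat.succ_le_succ ((Finset.card_insert_le _ _).trans
      (Nat.succ_le_succ ((Finset.card_insert_le _ _).trans (Nat.succ_le_succ (Finset.card_singleton _).le)))))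
  obtain ⟨Rset, hR, -⟩ := N.exists_isComplement_right 1
  have hRfin : Rset.Finite := Set.toFinite Rset
  set K : Finset G := hRfin.toFinset with hKdef
  have memK : ∀ r, r ∈ K ↔ r ∈ Rset := fun r => Set.Finite.mem_toFinset hRfin
  have cardK : Fintype.card G ≤ 4 * #K := by
    have e1 : #K = N.index := by rw [hKdef, ← hR.ncard_right, Set.ncard_eq_toFinset_card Rset hRfin]
    have e2 : Nat.card N * N.index = Nat.card G := N.card_mul_index
    rw [← Nat.card_eq_fintype_card, ← e2, e1]
    exact Nat.mul_le_mul_right _ cardN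
  have noN : ∀ n : G, n ∈ N → n ≠ 1 → ∀ b ∈ K, ∀ b' ∈ K, n * b ≠ b' := by
    intro n hn hn1 b hb b' hb' e
    have := @hR.1 (⟨n, hn⟩, ⟨b, (memK b).1 hb⟩) (⟨1, N.one_mem⟩, ⟨b', (memK b').1 hb'⟩) (by simpa using e)
    simp only [Prod.mk.injEq, Subtype.mk.injEq] at this
    exact hn1 this.1
  have h120 : c₁ * c₂ ≠ 1 := by
    intro e; apply h12
    calc c₁ = c₁ * (c₂ * c₂) := by rw [h22, mul_one]
      _ = c₁ * c₂ * c₂ := by rw [mul_assoc]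
      _ = c₂ := by rw [e, one_mul]
  have no1 := noN c₁ ((memN _).2 (Or.inr (Or.inl rfl))) h10
  have no2 := noN c₂ ((memN _).2 (Or.inr (Or.inr (Or.inl rfl)))) h20
  have no12 : ∀ b ∈ K, ∀ b' ∈ K, c₁ * (c₂ * b) ≠ b' := fun b hb b' hb' e =>
    noN (c₁ * c₂) ((memN _).2 (Or.inr (Or.inr (Or.inr rfl)))) h120 b hb b' hb' (by rw [mul_assoc]; exact e)
  -- the eight parts, indexed by `Fin 8`
  let U : Fin 8 → G × G × G := fun i => match i with
    | ⟨0, _⟩ => (c₁, 1, 1)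
    | ⟨1, _⟩ => (x⁻¹ * (c₁ * c₂), 1, x)
    | ⟨2, _⟩ => (w⁻¹ * (c₁ * c₂), 1, w)
    | ⟨3, _⟩ => (x⁻¹, x, 1)
    | ⟨4, _⟩ => (x⁻¹ * x⁻¹ * c₂, x, x)
    | ⟨5, _⟩ => (w⁻¹ * x⁻¹ * c₂, x, w)
    | ⟨6, _⟩ => (y⁻¹, y, 1)
    | ⟨7, _⟩ => (w⁻¹ * y⁻¹ * c₂, y, w)
    | ⟨n + 8, h⟩ => absurd h (by omega)
  let f : G × Fin 8 → G × G × G := fun p => ((U p.2).1 * p.1, (U p.2).2.1, (U p.2).2.2)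
  have finj : Set.InjOn f ↑(K ×ˢ (Finset.univ : Finset (Fin 8))) := by
    rintro ⟨k, i⟩ - ⟨k', i'⟩ - e
    have e23 : (U i).2 = (U i').2 := by
      have h2 := congrArg (fun P : G × G × G => P.2) e
      simpa [f] using h2
    have hii : i = i' := by
      fin_cases i <;> fin_cases i' <;>
        simp [U, hx1, hy1, hw1, hxy, hxw, hx1.symm, hy1.symm, hw1.symm, hxy.symm, hxw.symm] at e23 ⊢
    subst hii
    have e1 : (U i).1 * k = (U i).1 * k' := congrArg Prod.fst e
    rw [mul_left_cancel e1]
  set J : Finset (G × G × G) := (K ×ˢ (Finset.univ : Finset (Fin 8))).image f with hJ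
  have cardJ : #J = #K * 8 := by
    rw [hJ, Finset.card_image_of_injOn finj, Finset.card_product, Finset.card_univ, Fintype.card_fin]
  have memJ : ∀ {P : G × G × G}, P ∈ J → ∃ k ∈ K, ∃ i : Fin 8, P = ((U i).1 * k, (U i).2.1, (U i).2.2) := by
    intro P hP
    obtain ⟨⟨k, i⟩, hki, rfl⟩ := Finset.mem_image.1 hP
    exact ⟨k, (Finset.mem_product.1 hki).1, i, rfl⟩
  refine ⟨{1, x, y}, {1, x, w}, J, ?_, ?_, ?_, ?_, ?_⟩
  · rw [card_insert_of_notMem (by simp [hx1.symm, hy1.symm]), card_insert_of_notMem (by simpa using hxy), card_singleton]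
  · rw [card_insert_of_notMem (by simp [hx1.symm, hw1.symm]), card_insert_of_notMem (by simpa using hxw), card_singleton]
  · intro P hP
    obtain ⟨k, -, i, rfl⟩ := memJ hP
    simp only [mem_product, mem_univ, true_and, mem_insert, mem_singleton]
    fin_cases i <;> simp [U]
  · -- independence: 64 cases, one normalisation
    intro P hP P' hP' hne hw
    obtain ⟨k, hk, i, rfl⟩ := memJ hP
    obtain ⟨k', hk', i', rfl⟩ := memJ hP'
    fin_cases i <;> fin_cases i' <;> simp only [U, cellWord] at hw hne <;> have e := solve_left hw <;>
      simp only [mul_assoc, mul_inv_rev, inv_inv, inv_one, one_mul, mul_one, i1, i2, q1, q2,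
        cl1 x, cl1 x⁻¹, cl1 y, cl1 y⁻¹, cl1 w, cl1 w⁻¹, cl1 c₂, cl2 x, cl2 y, cl2 w,
        cyw.left_comm, cyw.inv_left.left_comm, cyw.inv_right.left_comm, cyw.inv_inv.left_comm,
        Rxy1, Rxy2, Ryx1, Rxw1, Rxw2, Rwx1, Rwx2, X1, X4, mul_inv_cancel_left, inv_mul_cancel_left] at e <;>
      first
        | exact (no1 k' hk' k hk e.symm).elim
        | exact (no2 k' hk' k hk e.symm).elim
        | exact (no12 k' hk' k hk e.symm).elim
        | (apply hne; rw [e])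
  · rw [cardJ]; omega

/-- **A finite group containing `x, y, w` with `y w = w y` and `[x,y] = c₁ ≠ c₂ = [x,w]` central involutions is NOT box-useful.**
[folklore] -/
theorem not_boxUseful_of_twoComm [Fintype G] [DecidableEq G] {x y w c₁ c₂ : G}
    (h1 : x * y * x⁻¹ * y⁻¹ = c₁) (h2 : x * w * x⁻¹ * w⁻¹ = c₂) (hyw : y * w = w * y)
    (hz1 : c₁ ∈ Subgroup.center G) (hz2 : c₂ ∈ Subgroup.center G) (h10 : c₁ ≠ 1) (h20 : c₂ ≠ 1) (h12 : c₁ ≠ c₂)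
    (h11 : c₁ * c₁ = 1) (h22 : c₂ * c₂ = 1) : ¬ BoxUseful G := by
  obtain ⟨Y, W, J, hY, hW, hJ, hind, hcard⟩ := exists_indep_twoComm h1 h2 hyw hz1 hz2 h10 h20 h12 h11 h22
  exact not_boxUseful_of_indep hY hW hJ hind (by omega)

end CommPairs

end Summit.MatrixMultiplication.OmegaCensus
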